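import Literature.Topology.FourManifolds.OneMaxBall
import Literature.Topology.FourManifolds.CerfPropositionFour
import HarnessLib

/-!
# Tools for Alexander's theorem: spheres from two discs, maps into submanifolds, defining
# functions of a common domain, removing a plug from a connected open set

Topic `Literature/Topology/FourManifolds`; general-purpose lemmas for the fact seat of
Alexander's theorem
(`provefact-Literature.Topology.FourManifolds.SphereEmbedding.schoenflies_exists_ball`,
Schultens, *Introduction to 3-Manifolds* (2014), Thm. 3.2.5), used in the absorption of the
induction ball ("by Lemma 3.2.3, `S` is isotopic to `S₁`", Schultens (2014), PDF p. 45) to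
parametrise the surgered sphere `S₂ = D ∪ D₂` and to locate its inside.  **Everything in this
file is proved; no definitions, no named facts.**

* §1 `SchoenfliesTools.isSmoothEmbedding_comp_inclusion`, `exists_isTwistedSphere`,
  `nonempty_diffeomorph_sphere_two` — **a smooth surface covered by two embedded closed discs
  meeting exactly along their common boundary circle is diffeomorphic to `𝕊²`**: it is a
  twisted sphere `𝔻² ∪_φ 𝔻²` (`IsTwistedSphere`, `TwistedSpheres.lean`), every `φ ∈ Diff(𝕊¹)`
  extends over `𝔻²` (`extendsOverBall_one`), and gluings are unique
  (`nonempty_diffeomorph_of_isTwistedSphere`, `BallGluingUniqueness.lean`) — this is how the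
  piecewise-smooth spheres `D ∪ Dᵢ` of Schultens' proof ("Set `S₁ = D ∪ D₁` and `S₂ = D ∪ D₂`.
  Then both `S₁` and `S₂` are piecewise smooth 2-spheres", PDF p. 45), once smoothed, are
  identified with `𝕊²` without any count of critical points;
* §2 `contMDiff_of_comp_isSmoothEmbedding`, `injective_mfderiv_of_comp_isSmoothEmbedding` —
  smoothness and immersivity of maps into an embedded submanifold are read off the composite
  with the embedding (`contMDiffOn_leftInverse_of_isImmersion`);
* §3 `exists_pos_fderiv_eq_smul_of_eventually_iff` — **two regular defining functions of the
  same domain have positively proportional differentials on the boundary**;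
  `combination_sign`, `fderiv_combination_ne_zero` — their convex combination by a cutoff
  defines the same domain and is regular on the boundary (no division lemma needed);
* §4 `isPreconnected_diff_of_shell` — **removing a plug from a connected open set**: if
  `X` is open connected, `K` closed, and a preconnected `R ⊆ X ∖ K` contains all points of
  `X ∖ K` near `K`, then `X ∖ K` is preconnected (used with `X` the exterior of the region and
  `K` the rim collar of the induction ball, to certify which side of the surgered sphere is
  the inside via the Euclidean side function of `SphereHypersurfaceSides.lean`).

## References

* J. Schultens, *Introduction to 3-Manifolds*, GSM 151, AMS (2014), proof of Thm. 3.2.5 (PDF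
  p. 45 of the held copy `book:schultens2014-introduction-3-manifolds`). [Schultens2014]
* J. Milnor, *Lectures on the h-cobordism theorem* (1965), §9 (twisted spheres).
  [MilnorHCobordism1965]
* M. W. Hirsch, *Differential Topology*, GTM 33 (1976), Ch. 8 Thm. 2.1. [HirschDT1976]
* J. M. Lee, *Introduction to Smooth Manifolds*, 2nd ed. (2013), Thm. 5.27, Cor. 5.30.
  [LeeSmoothManifolds2013]
-/

open scoped Manifold ContDiff Topology
open Set Function Metric Filter

noncomputable section

namespace Literature.Topology.FourManifolds

namespace SchoenfliesTools

variable {n : ℕ} {P : Type*} [TopologicalSpace P] [ChartedSpace (EuclideanSpace ℝ (Fin (n + 1))) P]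
  [IsManifold (𝓡 (n + 1)) ∞ P] [T2Space P]

/-- **The boundary circle of an embedded closed disc is an embedded sphere.** If
`j : 𝔻ⁿ⁺¹ → P` is a smooth embedding of the closed ball (manifold with boundary) into a
boundaryless manifold, then `j` restricted to the boundary sphere `𝕊ⁿ` is a smooth embedding
`𝕊ⁿ → P` (smooth as a composite with the inclusion `𝕊ⁿ ↪ 𝔻ⁿ⁺¹`, injective, with injective
differential by the chain rule; embedding because `𝕊ⁿ` is compact). [folklore] -/
theorem isSmoothEmbedding_comp_inclusion
    {j : closedBall (0 : EuclideanSpace ℝ (Fin (n + 1))) 1 → P}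
    (hj : Manifold.IsSmoothEmbedding (𝓡∂ (n + 1)) (𝓡 (n + 1)) ∞ j) :
    Manifold.IsSmoothEmbedding (𝓡 n) (𝓡 (n + 1)) ∞
      (j ∘ Set.inclusion (sphere_subset_closedBall :
        sphere (0 : EuclideanSpace ℝ (Fin (n + 1))) 1 ⊆ closedBall 0 1)) := by
  set ι := Set.inclusion (sphere_subset_closedBall :
        sphere (0 : EuclideanSpace ℝ (Fin (n + 1))) 1 ⊆ closedBall 0 1) with hι
  have hιemb : Manifold.IsSmoothEmbedding (𝓡 n) (𝓡∂ (n + 1)) ∞ ι :=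
    isSmoothEmbedding_sphereInclusion'_holds n
  have hc : ContMDiff (𝓡 n) (𝓡 (n + 1)) ∞ (j ∘ ι) := hj.contMDiff.comp hιemb.contMDiff
  have hinj : Injective (j ∘ ι) := hj.isEmbedding.injective.comp (Set.inclusion_injective _)
  refine isSmoothEmbedding_of_injective_of_injective_mfderiv hc (by exact_mod_cast le_top) hinj
    fun z => ?_
  have h1 : MDifferentiableAt (𝓡 n) (𝓡∂ (n + 1)) ι z := (hιemb.contMDiff z).mdifferentiableAt (by simp)
  have h2 : MDifferentiableAt (𝓡∂ (n + 1)) (𝓡 (n + 1)) j (ι z) :=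
    (hj.contMDiff (ι z)).mdifferentiableAt (by simp)
  rw [mfderiv_comp z h2 h1]
  exact (injective_mfderiv_of_isImmersionAt' (hj.isImmersion.isImmersionAt _)).comp
    (injective_mfderiv_of_isImmersionAt' (hιemb.isImmersion.isImmersionAt z))

/-- **A manifold covered by two embedded closed discs meeting exactly along their boundary
spheres, with the same boundary image, is a twisted sphere.** Let `jA, jB : 𝔻ⁿ⁺¹ → P` be
smooth embeddings with `jA(𝔻) ∪ jB(𝔻) = P`, `jA a = jB b` only for boundary points `a, b`,
and `jA(𝕊ⁿ) = jB(𝕊ⁿ)`.  Then `P = 𝔻ⁿ⁺¹ ∪_φ 𝔻ⁿ⁺¹` (`IsTwistedSphere n φ P`) for the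
diffeomorphism `φ = jB⁻¹ ∘ jA` of `𝕊ⁿ` (two embeddings of `𝕊ⁿ` with the same range differ by a
diffeomorphism, `ExpHeight.exists_diffeomorph_comp_eq_of_range_eq`). Milnor (1965), §9
(twisted spheres); Kervaire–Milnor (1963), §1. [folklore] -/
theorem exists_isTwistedSphere {jA jB : closedBall (0 : EuclideanSpace ℝ (Fin (n + 1))) 1 → P}
    (hA : Manifold.IsSmoothEmbedding (𝓡∂ (n + 1)) (𝓡 (n + 1)) ∞ jA)
    (hB : Manifold.IsSmoothEmbedding (𝓡∂ (n + 1)) (𝓡 (n + 1)) ∞ jB)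
    (hcover : range jA ∪ range jB = univ)
    (hAB : ∀ a b, jA a = jB b → ‖(a : EuclideanSpace ℝ (Fin (n + 1)))‖ = 1 ∧
      ‖(b : EuclideanSpace ℝ (Fin (n + 1)))‖ = 1)
    (hcirc : range (jA ∘ Set.inclusion (sphere_subset_closedBall :
        sphere (0 : EuclideanSpace ℝ (Fin (n + 1))) 1 ⊆ closedBall 0 1)) =
      range (jB ∘ Set.inclusion (sphere_subset_closedBall :
        sphere (0 : EuclideanSpace ℝ (Fin (n + 1))) 1 ⊆ closedBall 0 1))) :
    ∃ φ : (sphere (0 : EuclideanSpace ℝ (Fin (n + 1))) 1) ≃ₘ⟮𝓡 n, 𝓡 n⟯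
        (sphere (0 : EuclideanSpace ℝ (Fin (n + 1))) 1), IsTwistedSphere n φ P := by
  set ι := Set.inclusion (sphere_subset_closedBall :
        sphere (0 : EuclideanSpace ℝ (Fin (n + 1))) 1 ⊆ closedBall 0 1) with hι
  have hγA := isSmoothEmbedding_comp_inclusion hA
  have hγB := isSmoothEmbedding_comp_inclusion hB
  obtain ⟨φ, hφ⟩ := ExpHeight.exists_diffeomorph_comp_eq_of_range_eq hγA hγB hcirc
  refine ⟨φ, jA, jB, hA, hB, hcover, fun a b => ?_⟩
  rw [closedBallBoundaryData_incl]
  constructor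
  · intro hab
    obtain ⟨ha, hb⟩ := hAB a b hab
    have ha' : (a : EuclideanSpace ℝ (Fin (n + 1))) ∈ sphere (0 : EuclideanSpace ℝ (Fin (n + 1))) 1 :=
      mem_sphere_zero_iff_norm.2 ha
    have hb' : (b : EuclideanSpace ℝ (Fin (n + 1))) ∈ sphere (0 : EuclideanSpace ℝ (Fin (n + 1))) 1 :=
      mem_sphere_zero_iff_norm.2 hb
    refine ⟨⟨a, ha'⟩, Subtype.ext rfl, ?_⟩
    apply hB.isEmbedding.injective
    have e1 : ι ⟨(a : EuclideanSpace ℝ (Fin (n + 1))), ha'⟩ = a := Subtype.ext rfl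
    have e2 : ι ⟨(b : EuclideanSpace ℝ (Fin (n + 1))), hb'⟩ = b := Subtype.ext rfl
    have h1 : jB (ι (φ ⟨a, ha'⟩)) = jA (ι ⟨a, ha'⟩) := hφ _
    rw [e1, hab, ← e2] at h1
    rw [← e2]
    exact h1.symm
  · rintro ⟨z, rfl, rfl⟩
    exact (hφ z).symm

/-- **A surface covered by two embedded closed discs meeting exactly along their common boundary
circle is a sphere.**  If `jA, jB : 𝔻² → P` are smooth embeddings of the closed disc into a
Hausdorff smooth surface `P` with `jA(𝔻²) ∪ jB(𝔻²) = P`, `jA a = jB b` only for boundary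
points, and `jA(𝕊¹) = jB(𝕊¹)`, then `P ≅ 𝕊²`: `P` is the twisted sphere `𝔻² ∪_φ 𝔻²`
(`exists_isTwistedSphere`), every diffeomorphism of `𝕊¹` extends over `𝔻²`
(`extendsOverBall_one`), so `P = 𝔻² ∪_{id} 𝔻²` like `𝕊²` (`isDouble_sphere_holds`), and
gluings are unique up to diffeomorphism (`nonempty_diffeomorph_of_isTwistedSphere`). Milnor
(1965), §9; Hirsch (1976), Ch. 8 Thm. 2.1. [folklore] -/
theorem nonempty_diffeomorph_sphere_two {P : Type*} [TopologicalSpace P]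
    [ChartedSpace (EuclideanSpace ℝ (Fin 2)) P] [IsManifold (𝓡 2) ∞ P] [T2Space P]
    {jA jB : closedBall (0 : EuclideanSpace ℝ (Fin 2)) 1 → P}
    (hA : Manifold.IsSmoothEmbedding (𝓡∂ 2) (𝓡 2) ∞ jA)
    (hB : Manifold.IsSmoothEmbedding (𝓡∂ 2) (𝓡 2) ∞ jB)
    (hcover : range jA ∪ range jB = univ)
    (hAB : ∀ a b, jA a = jB b → ‖(a : EuclideanSpace ℝ (Fin 2))‖ = 1 ∧
      ‖(b : EuclideanSpace ℝ (Fin 2))‖ = 1)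
    (hcirc : range (jA ∘ Set.inclusion (sphere_subset_closedBall :
        sphere (0 : EuclideanSpace ℝ (Fin 2)) 1 ⊆ closedBall 0 1)) =
      range (jB ∘ Set.inclusion (sphere_subset_closedBall :
        sphere (0 : EuclideanSpace ℝ (Fin 2)) 1 ⊆ closedBall 0 1))) :
    Nonempty (P ≃ₘ⟮𝓡 2, 𝓡 2⟯ (sphere (0 : EuclideanSpace ℝ (Fin 3)) 1)) := by
  obtain ⟨φ, hT⟩ := exists_isTwistedSphere (n := 1) hA hB hcover hAB hcirc
  have hT' := hT.refl_of_extendsOverBall (extendsOverBall_one φ)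
  exact nonempty_diffeomorph_of_isTwistedSphere hT' (isTwistedSphere_refl_sphere isDouble_sphere_holds)

/-! ### §2 Maps into an embedded submanifold -/

section IntoEmbedded

variable {k : ℕ} {N : Type*} [TopologicalSpace N] [ChartedSpace (EuclideanSpace ℝ (Fin k)) N]
  {EM : Type*} [NormedAddCommGroup EM] [NormedSpace ℝ EM]
  {M : Type*} [TopologicalSpace M] [ChartedSpace EM M]
  {EX HX : Type*} [NormedAddCommGroup EX] [NormedSpace ℝ EX] [TopologicalSpace HX]
  {K : ModelWithCorners ℝ EX HX} {X : Type*} [TopologicalSpace X] [ChartedSpace HX X]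

/-- **Smoothness into an embedded submanifold.** If `e : N → M` is a smooth embedding of a
boundaryless manifold and `g : X → N` is such that `e ∘ g` is smooth, then `g` is smooth
(`g = e⁻¹ ∘ (e ∘ g)` with `e⁻¹` smooth on `range e`, `contMDiffOn_leftInverse_of_isImmersion`).
Lee (2013), Thm. 5.27 / Cor. 5.30. [folklore] -/
theorem contMDiff_of_comp_isSmoothEmbedding {e : N → M}
    (he : Manifold.IsSmoothEmbedding (𝓡 k) 𝓘(ℝ, EM) ∞ e) {g : X → N}
    (hg : ContMDiff K 𝓘(ℝ, EM) ∞ (e ∘ g)) : ContMDiff K (𝓡 k) ∞ g := by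
  rcases isEmpty_or_nonempty X with hX | hX
  · intro x; exact hX.elim x
  obtain ⟨x₀⟩ := hX
  haveI : Nonempty N := ⟨g x₀⟩
  set l : M → N := invFun e with hl
  have hle : LeftInverse l e := leftInverse_invFun he.isEmbedding.injective
  have hlc : ContMDiffOn 𝓘(ℝ, EM) (𝓡 k) ∞ l (range e) :=
    contMDiffOn_leftInverse_of_isImmersion he.isImmersion he.isEmbedding hle
  have hfun : g = l ∘ (e ∘ g) := funext fun x => (hle (g x)).symm
  rw [hfun]
  exact hlc.comp_contMDiff hg fun x => mem_range_self _

/-- **Injective differential into an embedded submanifold**: with `e`, `g` as above, if the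
differential of `e ∘ g` at `x` is injective then so is the differential of `g` (chain rule).
[folklore] -/
theorem injective_mfderiv_of_comp_isSmoothEmbedding {e : N → M}
    (he : Manifold.IsSmoothEmbedding (𝓡 k) 𝓘(ℝ, EM) ∞ e) {g : X → N}
    (hg : ContMDiff K 𝓘(ℝ, EM) ∞ (e ∘ g)) {x : X}
    (hinj : Injective (mfderiv K 𝓘(ℝ, EM) (e ∘ g) x)) : Injective (mfderiv K (𝓡 k) g x) := by
  have hgs := contMDiff_of_comp_isSmoothEmbedding he hg
  have h1 : MDifferentiableAt K (𝓡 k) g x := (hgs x).mdifferentiableAt (by simp)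
  have h2 : MDifferentiableAt (𝓡 k) 𝓘(ℝ, EM) e (g x) := (he.contMDiff (g x)).mdifferentiableAt (by simp)
  rw [mfderiv_comp x h2 h1] at hinj
  exact Injective.of_comp hinj

end IntoEmbedded

/-! ### §3 Defining functions of the same domain -/

section Defining

variable {E : Type*} [NormedAddCommGroup E] [InnerProductSpace ℝ E]

/-- **Two regular defining functions of the same domain have positively proportional
differentials on the boundary.** If `G₁`, `G₂` are differentiable, vanish at `z` with nonzero
differentials, and `{G₁ ≤ 0} = {G₂ ≤ 0}` near `z`, then `DG₂(z) = μ DG₁(z)` with `μ > 0`: a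
direction with `DG₁ < 0` enters `{G₁ < 0} ⊆ {G₂ ≤ 0}`, so `DG₂ ≤ 0` there; by continuity
`DG₁ ≤ 0 ⟹ DG₂ ≤ 0`, hence `ker DG₁ ⊆ ker DG₂` and the functionals are proportional
(`ExpHeight.exists_eq_smul_of_forall_eq_zero`), positively. [folklore] -/
theorem exists_pos_fderiv_eq_smul_of_eventually_iff {G₁ G₂ : E → ℝ} (h₁ : Differentiable ℝ G₁)
    (h₂ : Differentiable ℝ G₂) {z : E} (hz₁ : G₁ z = 0) (hz₂ : G₂ z = 0)
    (hD₁ : fderiv ℝ G₁ z ≠ 0) (hD₂ : fderiv ℝ G₂ z ≠ 0)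
    (hiff : ∀ᶠ x in 𝓝 z, G₁ x ≤ 0 ↔ G₂ x ≤ 0) :
    ∃ μ : ℝ, 0 < μ ∧ fderiv ℝ G₂ z = μ • fderiv ℝ G₁ z := by
  set A := fderiv ℝ G₁ z with hA
  set B := fderiv ℝ G₂ z with hB
  -- Step 1: `A d < 0 → B d ≤ 0`
  have step1 : ∀ d, A d < 0 → B d ≤ 0 := by
    intro d hd
    by_contra hBd
    push Not at hBd
    have hneg2 : fderiv ℝ (fun x => -G₂ x) z d < 0 := by
      rw [show (fun x => -G₂ x) = -G₂ from rfl, fderiv_neg]; simpa using hBd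
    have e1 := ExpHeight.exists_pos_apply_add_smul_neg h₁ hz₁ hd
    have e2 := ExpHeight.exists_pos_apply_add_smul_neg h₂.neg (by simp [hz₂]) hneg2
    -- along the line the equivalence holds eventually
    have hline : Tendsto (fun s : ℝ => z + s • d) (𝓝[>] 0) (𝓝 z) := by
      have : Tendsto (fun s : ℝ => z + s • d) (𝓝 0) (𝓝 (z + (0 : ℝ) • d)) :=
        (continuous_const.add (continuous_id.smul continuous_const)).tendsto 0
      rw [zero_smul, add_zero] at this
      exact this.mono_left nhdsWithin_le_nhds
    have e3 := hline.eventually hiff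
    obtain ⟨s, hs1, hs2, hs3⟩ := (e1.and (e2.and e3)).exists
    have : G₂ (z + s • d) ≤ 0 := hs3.1 hs1.le
    simp only [Pi.neg_apply, neg_lt_zero] at hs2
    linarith
  -- a direction with `A d₀ < 0`
  obtain ⟨u, hu⟩ : ∃ u, A u ≠ 0 := by
    by_contra hall
    push Not at hall
    exact hD₁ (ContinuousLinearMap.ext fun w => by simpa using hall w)
  obtain ⟨d₀, hd₀⟩ : ∃ d₀, A d₀ < 0 := by
    rcases lt_or_gt_of_ne hu with h | h
    · exact ⟨u, h⟩
    · exact ⟨-u, by rw [map_neg]; linarith⟩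
  have hBd₀ : B d₀ ≤ 0 := step1 d₀ hd₀
  -- Step 2: `A d ≤ 0 → B d ≤ 0`
  have step2 : ∀ d, A d ≤ 0 → B d ≤ 0 := by
    intro d hd
    have hε : ∀ ε : ℝ, 0 < ε → B d ≤ ε * (-B d₀) := by
      intro ε hε
      have h1 : A (d + ε • d₀) < 0 := by
        rw [map_add, map_smul, smul_eq_mul]; nlinarith
      have h2 := step1 _ h1
      rw [map_add, map_smul, smul_eq_mul] at h2
      linarith
    by_contra hpos
    push Not at hpos
    by_cases h0 : B d₀ = 0
    · have := hε 1 one_pos; rw [h0] at this; linarith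
    · have hlt : 0 < -B d₀ := by
        rcases hBd₀.lt_or_eq with h | h
        · linarith
        · exact absurd h h0
      have := hε (B d / (2 * -B d₀)) (by positivity)
      have e : B d / (2 * -B d₀) * -B d₀ = B d / 2 := by field_simp
      rw [e] at this
      linarith
  -- kernels are nested, so `B = μ A`
  have hker : ∀ w, A w = 0 → B w = 0 := fun w hw => by
    have h1 := step2 w hw.le
    have h2 := step2 (-w) (by rw [map_neg, hw, neg_zero])
    rw [map_neg] at h2
    linarith
  obtain ⟨μ, hμ⟩ := ExpHeight.exists_eq_smul_of_forall_eq_zero hD₁ hker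
  have hμ0 : 0 ≤ μ := by
    have h1 := step1 d₀ hd₀
    rw [hμ, FunLike.coe_smul, Pi.smul_apply, smul_eq_mul] at h1
    nlinarith
  have hμne : μ ≠ 0 := by
    rintro rfl
    rw [zero_smul] at hμ
    exact hD₂ hμ
  exact ⟨μ, lt_of_le_of_ne hμ0 (Ne.symm hμne), hμ⟩

/-- **Interpolating two defining functions of the same domain.** If `G₁ x ≤ 0 ↔ G₂ x ≤ 0` and
`G₁ x = 0 ↔ G₂ x = 0` (for a given `x`) then for `χ ∈ [0, 1]` the combination
`G = χ G₁ + (1 - χ) G₂` has `G x ≤ 0 ↔ G₁ x ≤ 0` and `G x = 0 ↔ G₁ x = 0`. [folklore] -/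
theorem combination_sign {a b χ : ℝ} (hχ0 : 0 ≤ χ) (hχ1 : χ ≤ 1) (hle : a ≤ 0 ↔ b ≤ 0)
    (heq : a = 0 ↔ b = 0) :
    (χ * a + (1 - χ) * b ≤ 0 ↔ a ≤ 0) ∧ (χ * a + (1 - χ) * b = 0 ↔ a = 0) := by
  have h1χ : 0 ≤ 1 - χ := by linarith
  -- positive case: both `a, b > 0` gives a positive combination
  have hpos : 0 < a → 0 < χ * a + (1 - χ) * b := fun ha => by
    have hb : 0 < b := by
      by_contra hb; push Not at hb; exact absurd (hle.2 hb) (not_le.2 ha)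
    rcases le_total a b with hab | hab
    · have := mul_le_mul_of_nonneg_left hab h1χ
      nlinarith
    · have := mul_le_mul_of_nonneg_left hab hχ0
      nlinarith
  have hneg : a < 0 → χ * a + (1 - χ) * b < 0 := fun ha => by
    have hb : b ≤ 0 := hle.1 ha.le
    have hb' : b ≠ 0 := fun hb0 => absurd (heq.2 hb0) ha.ne
    have hblt : b < 0 := lt_of_le_of_ne hb hb'
    rcases le_total a b with hab | hab
    · have := mul_le_mul_of_nonneg_left hab hχ0
      nlinarith
    · have := mul_le_mul_of_nonneg_left hab h1χ
      nlinarith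
  constructor
  · constructor
    · intro h
      by_contra ha
      push Not at ha
      linarith [hpos ha]
    · intro ha
      have hb := hle.1 ha
      nlinarith
  · constructor
    · intro h
      rcases lt_trichotomy a 0 with ha | ha | ha
      · linarith [hneg ha]
      · exact ha
      · linarith [hpos ha]
    · intro ha
      rw [ha, heq.1 ha]; ring

/-- **The interpolation of two regular defining functions is regular on the boundary.** At a
common zero `z` of `G₁`, `G₂` with `DG₂(z) = μ DG₁(z)`, `μ > 0`, `DG₁(z) ≠ 0`, the function
`G = χ G₁ + (1 - χ) G₂` (`χ` differentiable, `0 ≤ χ z ≤ 1`) has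
`DG(z) = (χ(z) + (1 - χ(z)) μ) DG₁(z) ≠ 0` (the term `(G₁ - G₂) Dχ` vanishes at `z`).
[folklore] -/
theorem fderiv_combination_ne_zero {G₁ G₂ χ : E → ℝ} {z : E} (h₁ : DifferentiableAt ℝ G₁ z)
    (h₂ : DifferentiableAt ℝ G₂ z) (hχ : DifferentiableAt ℝ χ z) (hz₁ : G₁ z = 0) (hz₂ : G₂ z = 0)
    (hD₁ : fderiv ℝ G₁ z ≠ 0) {μ : ℝ} (hμ : 0 < μ) (hprop : fderiv ℝ G₂ z = μ • fderiv ℝ G₁ z)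
    (hχ0 : 0 ≤ χ z) (hχ1 : χ z ≤ 1) :
    fderiv ℝ (fun x => χ x * G₁ x + (1 - χ x) * G₂ x) z = (χ z + (1 - χ z) * μ) • fderiv ℝ G₁ z ∧
      fderiv ℝ (fun x => χ x * G₁ x + (1 - χ x) * G₂ x) z ≠ 0 := by
  have hd0 : HasFDerivAt (fun x => χ x * G₁ x + (1 - χ x) * G₂ x)
      (χ z • fderiv ℝ G₁ z + G₁ z • fderiv ℝ χ z +
        ((1 - χ z) • fderiv ℝ G₂ z + G₂ z • ((0 : E →L[ℝ] ℝ) - fderiv ℝ χ z))) z := by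
    have e1 := hχ.hasFDerivAt.mul h₁.hasFDerivAt
    have e2 := ((hasFDerivAt_const (1 : ℝ) z).sub hχ.hasFDerivAt).mul h₂.hasFDerivAt
    exact e1.add e2
  have heqd : χ z • fderiv ℝ G₁ z + G₁ z • fderiv ℝ χ z +
        ((1 - χ z) • fderiv ℝ G₂ z + G₂ z • ((0 : E →L[ℝ] ℝ) - fderiv ℝ χ z)) =
      (χ z + (1 - χ z) * μ) • fderiv ℝ G₁ z := by
    rw [hz₁, hz₂, hprop, zero_smul, zero_smul, add_zero, add_zero, smul_smul, ← add_smul]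
  have hd : HasFDerivAt (fun x => χ x * G₁ x + (1 - χ x) * G₂ x)
      ((χ z + (1 - χ z) * μ) • fderiv ℝ G₁ z) z := heqd ▸ hd0
  refine ⟨hd.fderiv, ?_⟩
  rw [hd.fderiv]
  have hcoef : 0 < χ z + (1 - χ z) * μ := by
    rcases hχ0.lt_or_eq with hlt | heq
    · nlinarith
    · rw [← heq]; simpa using hμ
  intro h0
  rw [smul_eq_zero] at h0
  rcases h0 with h | h
  · linarith
  · exact hD₁ h

end Defining

/-! ### §4 Removing a plug from a connected open set -/

section Plug

variable {α : Type*} [TopologicalSpace α] [LocallyConnectedSpace α]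

/-- **Removing a plug from a connected open set.** Let `X` be a connected open subset of a
locally connected space, `K` a closed set ("the plug"), `U ⊇ K` open, and `R ⊆ X ∖ K` a
preconnected set containing every point of `(X ∖ K) ∩ U` (a connected shell around the plug
inside `X ∖ K`).  Then `X ∖ K` is preconnected: a component of `X ∖ K` avoiding `R` avoids `U`,
hence is clopen in `X`, hence is all of `X` — impossible unless `K` misses `X`, in which case
there is nothing to prove. [folklore] -/
theorem isPreconnected_diff_of_shell {X K U R : Set α} (hX : IsOpen X) (hXc : IsPreconnected X)
    (hK : IsClosed K) (hU : IsOpen U) (hKU : K ⊆ U) (hRsub : R ⊆ X \ K) (hR : IsPreconnected R)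
    (hUR : (X \ K) ∩ U ⊆ R) : IsPreconnected (X \ K) := by
  by_cases hKX : (K ∩ X).Nonempty
  swap
  · have : X \ K = X := by
      ext x
      exact ⟨fun h => h.1, fun hx => ⟨hx, fun hxK => hKX ⟨x, hxK, hx⟩⟩⟩
    rw [this]; exact hXc
  have hYo : IsOpen (X \ K) := hX.sdiff hK
  -- every component of `X \ K` meets `R`
  have key : ∀ y ∈ X \ K, (connectedComponentIn (X \ K) y ∩ R).Nonempty := by
    intro y hy
    by_contra hempty
    rw [not_nonempty_iff_eq_empty] at hempty
    set C := connectedComponentIn (X \ K) y with hC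
    have hCsub : C ⊆ X \ K := connectedComponentIn_subset _ _
    have hCU : C ∩ U = ∅ := by
      rw [eq_empty_iff_forall_notMem]
      rintro x ⟨hxC, hxU⟩
      have hxR : x ∈ R := hUR ⟨hCsub hxC, hxU⟩
      have : x ∈ C ∩ R := ⟨hxC, hxR⟩
      rw [hempty] at this; exact this
    have hCo : IsOpen C := hYo.connectedComponentIn
    -- `C` is closed in `X`
    have hCcl : ∀ x ∈ X, x ∈ closure C → x ∈ C := by
      intro x hxX hxcl
      have hxK : x ∉ K := fun hxK => by
        have : x ∈ closure C ∩ U := ⟨hxcl, hKU hxK⟩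
        obtain ⟨c, hc⟩ := mem_closure_iff_nhds.1 hxcl U (hU.mem_nhds (hKU hxK))
        rw [inter_comm, hCU] at hc
        exact hc
      have hxY : x ∈ X \ K := ⟨hxX, hxK⟩
      -- `C ∪ {x}` is preconnected and inside `X \ K`
      have hpre : IsPreconnected (insert x C) :=
        isPreconnected_connectedComponentIn.subset_closure (subset_insert _ _)
          (insert_subset hxcl subset_closure)
      have hyC : y ∈ insert x C := mem_insert_of_mem _ (mem_connectedComponentIn hy)
      have := hpre.subset_connectedComponentIn hyC (insert_subset hxY hCsub)
      exact this (mem_insert _ _)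
    -- hence `C = X`, contradicting `K ∩ X ≠ ∅`
    have hCX : X ⊆ C := by
      refine hXc.subset_left_of_subset_union (u := C) (v := (closure C)ᶜ) hCo
        isClosed_closure.isOpen_compl ?_ ?_ ⟨y, hy.1, mem_connectedComponentIn hy⟩
      · exact Set.disjoint_left.2 fun c hc hc' => hc' (subset_closure hc)
      · intro x hxX
        by_cases hx : x ∈ closure C
        · exact Or.inl (hCcl x hxX hx)
        · exact Or.inr hx
    obtain ⟨k, hkK, hkX⟩ := hKX
    exact (hCsub (hCX hkX)).2 hkK
  -- conclude by joining any two points through `R`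
  refine isPreconnected_of_forall_pair fun y hy y' hy' => ?_
  obtain ⟨r, hrC, hrR⟩ := key y hy
  obtain ⟨r', hr'C, hr'R⟩ := key y' hy'
  refine ⟨connectedComponentIn (X \ K) y ∪ R ∪ connectedComponentIn (X \ K) y', ?_,
    Or.inl (Or.inl (mem_connectedComponentIn hy)), Or.inr (mem_connectedComponentIn hy'), ?_⟩
  · exact union_subset (union_subset (connectedComponentIn_subset _ _) hRsub)
      (connectedComponentIn_subset _ _)
  · refine (isPreconnected_connectedComponentIn.union r hrC hrR hR).union r' (Or.inr hr'R) hr'C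
      isPreconnected_connectedComponentIn

end Plug

end SchoenfliesTools

end Literature.Topology.FourManifolds
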